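import Mathlib
import Summits.Ventures.PercRepro2.K5Theorem
import Summits.Ventures.PercRepro2.HubBernstein
import Summits.Ventures.PercRepro2.PMK5Kernel
import Summits.Ventures.PercRepro2.PMK5KernelA
import Summits.Ventures.PercRepro2.PMK5Bridge
import Summits.Ventures.PercRepro2.PMK5Theorem

/-!
# THE EQUALITY LOCUS OF `(HALF-PM⁺)_L` ON `K₅` IS EMPTY: the L-half of the weighted (PM) is STRICTLY positive
at every interior weight vector (blind cell PercRepro2, mine-2 g22; row 2′BETA1; «equality locus first»,
M2-44 (20))

A tensor-Bernstein form with nonnegative coefficients and ONE positive coefficient is `> 0` on the open cube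
(every basis polynomial `bern p k` is `> 0` for `p ∈ (0,1)^10`).  The kernel digit `PM.digitL` reads the
coefficient of the profile `k₀ = (1, 1, 1, 2, 0, 1, 1, 1, 1, 1)` (index `349333`) off `kPosL − kNegL`: it is `446`
(`coefL_pos`, through `K5.digit_sum`).  Hence **`halfL_K5_pos`**: on `K₅` with the five marks
`(o, a₁, a₂, u, b) = (0, 1, 2, 3, 4)`, `P(Q)³·(HALF-PM⁺)_L > 0` whenever `0 < p_e < 1` for every edge —
equality with interior weights never occurs on the complete block; the zeros of the per-side bracket live on the
boundary of the cube (a smaller graph: the root-pair separations of Theorem 7 (i)/(ii)).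
-/

namespace Summit.Ventures.PercRepro2

open Hub

namespace K5

namespace PM

/-! ## The digit of the difference at one profile -/

section Digit

/-- **The digit argument, abstractly** (all Kronecker numbers as VARIABLES, as in `K5.le_of_kron_le`: a
closed `ℕ` term of this size must never reach a kernel defeq check): if `P = Σ_k a k KB^{idx4 k}`,
`M = Σ_k b k KB^{idx4 k}` with `a < 2^19`, `b ≤ a` termwise, and the base-`KB` digit of `P − M` at the index
`j < 4^10` is `c > 0`, then `b (decode4 j) < a (decode4 j)`. -/
theorem digit_lt_of_kron (a b : (Fin 10 → Fin 4) → ℕ) (ha : ∀ k, a k < 2 ^ 19) (hab : ∀ k, b k ≤ a k)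
    {P M : ℕ} (hP : P = ∑ k, a k * KB ^ idx4 k) (hM : M = ∑ k, b k * KB ^ idx4 k)
    (j : ℕ) (hj : j < 4 ^ 10) {c : ℕ} (hdig : (P - M) / KB ^ j % KB = c) (hc : 0 < c) :
    b (decode4 j) < a (decode4 j) := by
  have hKB : 2 ≤ KB := by rw [KB_eq]; norm_num
  have h19 : (2 : ℕ) ^ 19 < KB := by rw [KB_eq]; norm_num
  -- `P − M` is the Kronecker sum of the signed counts (no borrow: the counts are termwise ordered)
  have hD : P - M = ∑ k, (a k - b k) * KB ^ idx4 k := by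
    have h : ∑ k, (a k - b k) * KB ^ idx4 k + ∑ k, b k * KB ^ idx4 k = ∑ k, a k * KB ^ idx4 k := by
      rw [← Finset.sum_add_distrib]
      exact Finset.sum_congr rfl fun k _ => by rw [← add_mul, Nat.sub_add_cancel (hab k)]
    omega
  -- its digit at `j` is the signed count of the profile `decode4 j`
  have hd : (P - M) / KB ^ j % KB = a (decode4 j) - b (decode4 j) := by
    rw [hD, sum_profiles_eq]
    exact digit_sum hKB (fun j => a (decode4 j) - b (decode4 j)) (4 ^ 10)
      (fun j _ => by have := ha (decode4 j); omega) j hj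
  rw [hdig] at hd
  omega

/-- **The coefficient of the profile `(1, 1, 1, 2, 0, 1, 1, 1, 1, 1)` is strictly positive** (`= 446`, the
kernel digit `digitL`). -/
theorem coefL_pos : cntNegL (decode4 349333) < cntPosL (decode4 349333) :=
  digit_lt_of_kron cntPosL cntNegL cntPosL_lt cntNegL_le_cntPosL kPosL_eq kNegL_eq 349333 (by norm_num)
    digitL (by norm_num)

end Digit

/-! ## Strict positivity on the open cube -/

section Strict

variable {R : Type*} [Field R] [LinearOrder R] [IsStrictOrderedRing R]

/-- The Bernstein basis is positive on the open cube. -/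
lemma bern_pos {q : Fin 10 → R} (hq : ∀ i, 0 < q i ∧ q i < 1) (k : Fin 10 → Fin 4) : 0 < bern q k := by
  unfold bern
  exact Finset.prod_pos fun i _ => mul_pos (pow_pos (hq i).1 _) (pow_pos (sub_pos.2 (hq i).2) _)

/-- **THE L-HALF OF THE WEIGHTED (PM) IS STRICTLY POSITIVE ON `K₅` FOR EVERY INTERIOR WEIGHT VECTOR**
(`0 < p_e < 1` for all ten edges): the equality locus of `(HALF-PM⁺)_L` on the complete block is empty. -/
theorem halfL_K5_pos (p : Fin 10 → R) (hp : ∀ i, 0 < p i ∧ p i < 1) :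
    0 < prob p (connEvent ends5 1 2)ᶜ *
          (prob p (connEvent ends5 1 2)ᶜ *
              prob p (connEvent ends5 1 4 ∩ connEvent ends5 2 3 ∩
                (connEvent ends5 1 0 ∪ connEvent ends5 2 0) ∩ (connEvent ends5 1 2)ᶜ) -
            prob p (connEvent ends5 1 4 ∩ (connEvent ends5 1 2)ᶜ) *
              prob p (connEvent ends5 2 3 ∩ (connEvent ends5 1 0 ∪ connEvent ends5 2 0) ∩
                (connEvent ends5 1 2)ᶜ)) -
        prob p ((connEvent ends5 1 0 ∪ connEvent ends5 2 0) ∩ (connEvent ends5 1 2)ᶜ) *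
          (prob p (connEvent ends5 1 2)ᶜ *
              prob p (connEvent ends5 1 4 ∩ connEvent ends5 2 3 ∩ (connEvent ends5 1 2)ᶜ) -
            prob p (connEvent ends5 1 4 ∩ (connEvent ends5 1 2)ᶜ) *
              prob p (connEvent ends5 2 3 ∩ (connEvent ends5 1 2)ᶜ)) -
        prob p (connEvent ends5 1 2)ᶜ *
          (prob p (connEvent ends5 1 2)ᶜ *
              prob p (connEvent ends5 1 4 ∩ connEvent ends5 2 0 ∩ (connEvent ends5 1 2)ᶜ) -
            prob p (connEvent ends5 1 4 ∩ (connEvent ends5 1 2)ᶜ) *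
              prob p (connEvent ends5 2 0 ∩ (connEvent ends5 1 2)ᶜ)) := by
  rw [halfL_eq_bern]
  have hb : ∀ k ∈ (Finset.univ : Finset (Fin 10 → Fin 4)),
      0 ≤ bern p k * ((cntPosL k : ℕ) - (cntNegL k : ℕ) : R) := fun k _ =>
    mul_nonneg (bern_nonneg (fun i => ⟨(hp i).1.le, (hp i).2.le⟩) k)
      (by rw [sub_nonneg]; exact_mod_cast cntNegL_le_cntPosL k)
  refine lt_of_lt_of_le ?_ (Finset.single_le_sum hb (Finset.mem_univ (decode4 349333)))
  refine mul_pos (bern_pos hp _) ?_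
  rw [sub_pos]
  exact Nat.cast_lt.mpr coefL_pos

end Strict

end PM

end K5

end Summit.Ventures.PercRepro2
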